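import Summits.BirchSwinnertonDyer.BirchSwinnertonDyer.Theorems.AdditiveBranchIMCGordTwoRankOneHeegnerKolyvaginManinKept
import Summits.BirchSwinnertonDyer.BirchSwinnertonDyer.Theorems.AdditiveBranchIMCGordTwoRankOneHeegnerKolyvagin
import HarnessLib

/-!
# Route `AdditiveBranchIMC` (rung K1), crux `GordTwoRankOne` (item 19358): the Heegner–Kolyvagin road,
# Part 5 — the Manin-FREE lower half and the rider-free class-level theorem
# (cell `bsd-addord`, second prover lane `bsd-addord-k1-c3x`, gen 0; `--supports` only)

HONEST FRAMING. THEOREMS ONLY: no definition, no new named fact, no `sorry`; nothing is booked; BSD is not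
proved by any of this; the crux stays OPEN at class level. With the Manin term kept in the Gross–Zagier
bookkeeping identity (Part 4, `exists_shaAn_padicVal_eq_of_heegner_maninKept`), the Manin-unit binder
`p ∤ c(Dt)` disappears from the LOWER half: `ord_p c(Dt) ≥ 0` only lowers `ord_p #Ш(E)_an`. Hence:

* §7 `missingLowerBoundAt_of_indexLowerBoundAt_maninFree` (class-free, ANY reduction at `p`) and the
  pointwise door `missingLowerBoundAt_rankOne_additive_of_indexLowerBoundAt_maninFree` at an additive
  potentially good prime — PUBLISHED binders (`hGZ`, `hKo`, `hKatoT`, `hGZK`, `hmod`) + STEP L_add only.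
* §8 CLASS LEVEL, rider-free: `cellGordTwo_missingLowerBoundAt_rankOne_of_towerSurj_of_indexLowerBoundAt'` —
  for every globally minimal `E/ℚ` with `ord_{s=1}L(E,s) = 1` and every pair of cell (G-ord, `e = 2`) with
  `ρ̄_{E,p^n}` onto for all `n` (EVERY odd `p`, `p = 3` included): `Typed.MissingLowerBoundAt W p`, from the
  PUBLISHED facts Gross–Zagier, Kolyvagin (qualitative), Kato 2004 Thm 14.5 (3) Tamagawa-exact, GZK,
  modularity (root number; a parametrisation at the conductor level), Friedberg–Hoffstein — and ONE typed
  input, STEP L_add (`hL`: `X11b.IndexLowerBoundAt W p K P` at every Heegner datum of such a pair, granted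
  finiteness of `Ш(E/K)`) — OPEN at an additive prime (Part 2's docstring: in print only at `p ∤ N`, as
  "anticyclotomic IMC divisibility + BDP formula" or W. Zhang's `p`-indivisibility of the Kolyvagin system).
  Part 2's theorem of the same name (without the prime) is the version with the Edixhoven discharge at
  `p ≥ 11` and a Manin rider at `p ≤ 7`; this one supersedes it. The crux BY NAME is Part 3
  (`…HeegnerKolyvaginByName.lean`).

References: [JetchevSkinnerWan2017] §7.4.1; [Kato2004Asterisque] Thm 14.5 (3); [FriedbergHoffstein1995];
[GrossZagier1986] V.§2; [McCallumLMS1991] §1; [Miller2011LMS] Def 1.1.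
-/

set_option autoImplicit false
set_option linter.dupNamespace false
noncomputable section

open scoped Classical NumberField
open WeierstrassCurve NumberField IsDedekindDomain
  Literature.NumberTheory.EllipticCurves Literature.NumberTheory.EllipticCurves.ModularForms
  Literature.NumberTheory.EllipticCurves.Rank1Residual
  Literature.NumberTheory.EllipticCurves.Rank1Residual.Typed
  Summit.BirchSwinnertonDyer.Rank1Residual
  Summit.BirchSwinnertonDyer.Rank1Residual.Additive
  Summit.BirchSwinnertonDyer.Rank1Residual.X11b
  Summit.BirchSwinnertonDyer.Rank1Residual.GaloisImage
  Literature.NumberTheory.Automorphic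

namespace Summit.BirchSwinnertonDyer.BirchSwinnertonDyer.Theorems.AdditiveBranchIMCGordTwoRankOne.HeegnerKolyvagin

/-! ### §7 The Manin-FREE lower half -/

/-- **The main-conjecture half from a STEP-L-shaped input — NO Manin datum, Tamagawa transport as an
inequality.** As Part 1's `missingLowerBoundAt_of_indexLowerBoundAt_le` (Jetchev–Skinner–Wan 2017 §7.4.1,
class-free, ANY reduction type at `p`) with the binder `p ∤ c(Dt)` deleted: by
`exists_shaAn_padicVal_eq_of_heegner_maninKept`, `v(q) = 2v(I) − v(q_d) − v(c_W) − 2v(t_d) − 2v(c) ≤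
2v(I) − v(q_d) − v(c_W) − 2v(t_d)` since `v(c) ≥ 0` (`c ∈ ℤ`), and the rest of the arithmetic is unchanged.
[cite: JetchevSkinnerWan2017, §7.4.1 (eq:shalowerK-1)–(eq:shalower), pp. 30–31] [cite: Miller2011LMS, Def. 1.1] -/
theorem missingLowerBoundAt_of_indexLowerBoundAt_maninFree
    (W : WeierstrassCurve ℚ) [W.IsElliptic] [W.IsGloballyMinimal] (p : ℕ) [Fact p.Prime]
    (N : ℕ) [NeZero N] (K : Type) [Field K] [NumberField K]
    (Dt : ModularParametrizationData W N) (H : HeegnerDatum N (NumberField.discr K)) (ι : K →+* ℂ)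
    (P : (W.baseChange K).toAffine.Point)
    (hGZ : gross_zagier N W K) (hKo : kolyvagin N W K)
    (hGZK : rank_eq_analyticRank_of_analyticRank_le_one) (hmod : hasEntireLFunction_rat)
    (hK : IsImaginaryQuadratic K) (hHN : SatisfiesHeegnerHypothesis N K)
    (hP : WeierstrassCurve.Affine.Point.map ι.toRatAlgHom P = heegnerPointComplex Dt H)
    (hp2 : p ≠ 2) (hμ : ¬ p ∣ Units.torsionOrder K)
    (hr : W.analyticRank = 1)
    (hLt : (W.quadraticTwist (NumberField.discr K : ℚ)).entireLFunction 1 ≠ 0)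
    (Wd : WeierstrassCurve ℚ) [Wd.IsElliptic] [Wd.IsGloballyMinimal] (Cd : VariableChange ℚ)
    (hWd : Cd • W.quadraticTwist (NumberField.discr K : ℚ) = Wd)
    (hu : padicValRat p (Cd.u : ℚ) = 0)
    (htam : padicValNat p W.tamagawaProduct ≤ padicValNat p Wd.tamagawaProduct)
    (htw : ∃ q : ℚ, Wd.entireLFunction 1 / (Wd.realPeriodRat : ℂ) = (q : ℂ) ∧
      (padicValNat p Wd.shaOrder : ℤ) + padicValNat p Wd.tamagawaProduct -
        2 * padicValNat p Wd.torsionOrder ≤ padicValRat p q)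
    (hL : Finite (W.baseChange K).sha → IndexLowerBoundAt W p K P) :
    Typed.MissingLowerBoundAt W p := by
  obtain ⟨qd, hqd, hvqd⟩ := htw
  obtain ⟨-, hfinK, hsha, q, hq, hval⟩ := exists_shaAn_padicVal_eq_of_heegner_maninKept W p N K Dt H ι P
    hGZ hKo hGZK hmod hK hHN hP hp2 hμ hr hLt Wd Cd hWd hu qd hqd
  have hKL := hL hfinK
  unfold IndexLowerBoundAt at hKL
  refine ⟨q, hq, ?_⟩
  have hc0 : (0 : ℤ) ≤ padicValRat p (Dt.c : ℚ) := by
    rw [padicValRat.of_int]; positivity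
  have e1 : (2 * padicValNat p (AddSubgroup.zmultiples P).index : ℤ) ≤
      padicValNat p (W.baseChange K).shaOrder + 2 * padicValNat p W.tamagawaProduct := by
    exact_mod_cast hKL
  have e2 : (padicValNat p (W.baseChange K).shaOrder : ℤ) =
      padicValNat p W.shaOrder + padicValNat p Wd.shaOrder := by exact_mod_cast hsha
  have e3 : (padicValNat p W.tamagawaProduct : ℤ) ≤ padicValNat p Wd.tamagawaProduct := by
    exact_mod_cast htam
  linarith

/-- **THE POINTWISE LOWER HALF at an additive potentially good prime from STEP L_add — NO Manin datum.**
Part 1's `missingLowerBoundAt_rankOne_additive_of_indexLowerBoundAt` with the binder `p ∤ c(Dt)` deleted: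
`W/ℚ` globally minimal, `ord_{s=1} L(E,s) = 1`, `p` odd, `E` additive at `p` with `0 ≤ ord_p j(E)` and
`ρ̄_{E,p^n}` onto for all `n`; `K` Heegner for the conductor with `p ∤ #𝓞_K^×`, `L(E^{d_K},1) ≠ 0`; `P ∈ E(K)`
the Heegner point of ANY datum `Dt`; `Wd` a globally minimal model of the twist. PUBLISHED binders `hGZ`,
`hKo`, `hKatoT` (Kato 14.5 (3) Tamagawa-exact, for the twist), `hGZK`, `hmod`. CONCLUSION: STEP L at `P` ⇒
`Typed.MissingLowerBoundAt W p`. The only non-published input of the road at the pair is STEP L_add.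
[cite: JetchevSkinnerWan2017, §7.4.1 (pp. 29–31)] [cite: Kato2004Asterisque, Thm. 14.5 (3) (p. 236)]
[cite: Miller2011LMS, Def. 1.1] -/
theorem missingLowerBoundAt_rankOne_additive_of_indexLowerBoundAt_maninFree
    (W : WeierstrassCurve ℚ) [W.IsElliptic] [W.IsGloballyMinimal] (p : ℕ) [Fact p.Prime]
    [NeZero (W.conductorNorm ℤ)] (K : Type) [Field K] [NumberField K]
    (Dt : ModularParametrizationData W (W.conductorNorm ℤ))
    (H : HeegnerDatum (W.conductorNorm ℤ) (NumberField.discr K)) (ι : K →+* ℂ)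
    (P : (W.baseChange K).toAffine.Point)
    -- the published inputs (named facts of the tree)
    (hGZ : gross_zagier (W.conductorNorm ℤ) W K) (hKo : kolyvagin (W.conductorNorm ℤ) W K)
    (hKatoT : Kato2004.rankZero_padicValNat_sha_add_padicValNat_tamagawa_le_of_additive_potGood_of_imageContainsSL2)
    (hGZK : rank_eq_analyticRank_of_analyticRank_le_one) (hmod : hasEntireLFunction_rat)
    -- the pair
    (hr : W.analyticRank = 1) (hp2 : p ≠ 2) (hadd : Addv W p) (hj : 0 ≤ padicValRat p W.j)
    (hsurj : ∀ n : ℕ, W.HasSurjectiveModNGaloisRep (p ^ n : ℕ))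
    -- the Heegner data
    (hK : IsImaginaryQuadratic K) (hHN : SatisfiesHeegnerHypothesis (W.conductorNorm ℤ) K)
    (hP : WeierstrassCurve.Affine.Point.map ι.toRatAlgHom P = heegnerPointComplex Dt H)
    (hμ : ¬ p ∣ Units.torsionOrder K)
    (hLt : (W.quadraticTwist (NumberField.discr K : ℚ)).entireLFunction 1 ≠ 0)
    (Wd : WeierstrassCurve ℚ) [Wd.IsElliptic] [Wd.IsGloballyMinimal] (Cd : VariableChange ℚ)
    (hWd : Cd • W.quadraticTwist (NumberField.discr K : ℚ) = Wd)
    -- STEP L_add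
    (hL : Finite (W.baseChange K).sha → IndexLowerBoundAt W p K P) :
    Typed.MissingLowerBoundAt W p := by
  have hD0 : (NumberField.discr K : ℚ) ≠ 0 := by exact_mod_cast NumberField.discr_ne_zero K
  haveI hEt : (W.quadraticTwist (NumberField.discr K : ℚ)).IsElliptic := W.isElliptic_quadraticTwist hD0
  have haddd : Addv Wd p := addv_twist_of_heegner W p K hK hHN hadd Cd hWd
  have hjd : 0 ≤ padicValRat p Wd.j := by
    have hjeq : Wd.j = W.j := by subst hWd; rw [variableChange_j, W.j_quadraticTwist hD0]
    rw [hjeq]; exact hj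
  have hsurjd : ∀ n : ℕ, Wd.HasSurjectiveModNGaloisRep (p ^ n : ℕ) := fun n ↦
    (hasSurjectiveModNGaloisRep_pow_iff_of_model_twist W p hD0 ⟨Cd, hWd⟩ n).mpr (hsurj n)
  have htam : padicValNat p W.tamagawaProduct ≤ padicValNat p Wd.tamagawaProduct :=
    padicValNat_tamagawaProduct_le_twist_of_heegner W p K hK hHN Cd hWd
  have hu : padicValRat p (Cd.u : ℚ) = 0 :=
    padicValRat_u_eq_zero_of_twist_minimal' W p K hK hHN hadd.1 Cd hWd
  have hLt' : (W.quadraticTwist (NumberField.discr K : ℚ)).entireLFunction = Wd.entireLFunction := by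
    rw [← hWd, entireLFunction_smul]
  have hLd1 : Wd.entireLFunction 1 ≠ 0 := by rw [← hLt']; exact hLt
  have htw := twist_le_half_of_katoTamagawaExact hKatoT hGZK hmod Wd p hp2 haddd hjd hsurjd hLd1
  exact missingLowerBoundAt_of_indexLowerBoundAt_maninFree W p (W.conductorNorm ℤ) K Dt H ι P hGZ hKo hGZK
    hmod hK hHN hP hp2 hμ hr hLt Wd Cd hWd hu htam htw hL

/-! ### §8 CLASS LEVEL, rider-free: the crux on the tower-surjective rows from PUBLISHED facts + STEP L_add -/

/-- **Crux `GordTwoRankOne` (item 19358) on every tower-surjective pair of cell (G-ord, `e = 2`), from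
PUBLISHED facts and ONE STEP-L-shaped input — no Manin rider, every odd `p`.** PUBLISHED binders:
Gross–Zagier `hGZ`, Kolyvagin (qualitative) `hKo`, Kato 2004 Thm. 14.5 (3) Tamagawa-exact at an additive
potentially good prime `hKatoT` (for the rank-`0` TWIST), GZK `hGZK`, modularity `hmod` / `hnf` (root number
`−1`) / `hmodP` (a parametrisation at the conductor level, ANY Manin constant), Friedberg–Hoffstein `hFH` (the
auxiliary field: every `ℓ ∣ N` split, `|d_K| > 4`, `L(E^{d_K},1) ≠ 0`), and the Heegner-datum existence
theorems of the tree (Gross 1984 §I.1, Darmon 2004 Thm. 3.6). THE TYPED INPUT `hL` — STEP L_add: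
`X11b.IndexLowerBoundAt W p K P` at every Heegner datum of such a pair, granted finiteness of `Ш(E/K)` —
OPEN at an additive prime. CONCLUSION: for every globally minimal `E/ℚ` with `ord_{s=1}L(E,s) = 1` and
every pair of the cell with `ρ̄_{E,p^n}` onto for all `n`: `ord_p #Ш(E)_an ≤ ord_p #Ш(E)`. No Λ-adic branch
object, no `p`-adic height / Schneider / `A′`, no Tamagawa or Manin condition. Nothing is booked; the crux
stays OPEN. [cite: JetchevSkinnerWan2017, §7.4.1 (pp. 29–31)] [cite: Kato2004Asterisque, Thm. 14.5 (3) (p. 236)]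
[cite: Darmon2004, Thm. 3.6 and §3.7] [cite: Miller2011LMS, Def. 1.1] -/
theorem cellGordTwo_missingLowerBoundAt_rankOne_of_towerSurj_of_indexLowerBoundAt'
    -- published inputs (named facts of the tree)
    (hGZ : ∀ (N : ℕ) [NeZero N] (W : WeierstrassCurve ℚ) (K : Type) [Field K] [NumberField K],
      gross_zagier N W K)
    (hKo : ∀ (N : ℕ) [NeZero N] (W : WeierstrassCurve ℚ) (K : Type) [Field K] [NumberField K],
      kolyvagin N W K)
    (hKatoT : Kato2004.rankZero_padicValNat_sha_add_padicValNat_tamagawa_le_of_additive_potGood_of_imageContainsSL2)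
    (hGZK : rank_eq_analyticRank_of_analyticRank_le_one) (hmod : hasEntireLFunction_rat)
    (hnf : exists_isNewformOf) (hmodP : nonempty_modularParametrizationData)
    (hFH : friedbergHoffstein_exists_heegnerField_split_twist_ne_zero)
    -- the typed input of the road (STEP L_add), at every Heegner datum
    (hL : ∀ (W : WeierstrassCurve ℚ) [W.IsElliptic] [W.IsGloballyMinimal] (p : ℕ) [Fact p.Prime]
      (N : ℕ) [NeZero N] (K : Type) [Field K] [NumberField K]
      (Dt : ModularParametrizationData W N) (H : HeegnerDatum N (NumberField.discr K)) (ι : K →+* ℂ)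
      (P : (W.baseChange K).toAffine.Point),
      W.analyticRank = 1 → N10.CellGordTwo W p → (∀ n : ℕ, W.HasSurjectiveModNGaloisRep (p ^ n : ℕ)) →
      W.conductorNorm ℤ = N → IsImaginaryQuadratic K → SatisfiesHeegnerHypothesis N K →
      WeierstrassCurve.Affine.Point.map ι.toRatAlgHom P = heegnerPointComplex Dt H →
      Finite (W.baseChange K).sha → IndexLowerBoundAt W p K P) :
    ∀ (W : WeierstrassCurve ℚ) [W.IsElliptic] [W.IsGloballyMinimal] (p : ℕ) [Fact p.Prime],
      W.analyticRank = 1 → N10.CellGordTwo W p →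
      (∀ n : ℕ, W.HasSurjectiveModNGaloisRep (p ^ n : ℕ)) → Typed.MissingLowerBoundAt W p := by
  intro W _ _ p _ hr hc2 hsurj
  have hp : p.Prime := Fact.out
  obtain ⟨hp2, hadd, hG, he⟩ := hc2
  haveI : NeZero (W.conductorNorm ℤ) := ⟨(W.conductorNorm_pos_holds).ne'⟩
  -- potentially good: `0 ≤ ord_p j`
  have hj : 0 ≤ padicValRat p W.j := not_lt.mp (N10.not_potMult_of_typeGOrd W p hp2 hadd hG)
  -- the sign of the functional equation is `−1` (modularity, `r_an = 1`)
  have hw : W.rootNumber = -1 := by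
    rw [WeierstrassCurve.rootNumber_eq_neg_one_pow_analyticRank_of_exists_isNewformOf hnf W, hr]
    norm_num
  -- the auxiliary field (Friedberg–Hoffstein): every `ℓ ∣ N` split, `|d_K| > 4`, `L(E^{d_K},1) ≠ 0`
  obtain ⟨K, _, _, hK, hdisc, hHN, -, hLt⟩ := hFH W hw p hp 4
  -- `w_K = 2`, prime to the odd prime `p`
  have hμ : ¬ p ∣ Units.torsionOrder K := by
    haveI : IsTotallyComplex K := hK.2
    have hneg : NumberField.discr K < 0 := discr_neg_of_finrank_eq_two K hK.1
    have habs : ((NumberField.discr K).natAbs : ℤ) = -NumberField.discr K :=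
      Int.ofNat_natAbs_of_nonpos hneg.le
    have h4 : NumberField.discr K < -4 := by
      have : (4 : ℤ) < ((NumberField.discr K).natAbs : ℤ) := by exact_mod_cast hdisc
      omega
    rw [Literature.NumberTheory.DiophantineGeometry.torsionOrder_eq_two_of_discr_lt hK.1 h4]
    intro h2
    have := Nat.le_of_dvd two_pos h2
    have h2le : 2 ≤ p := hp.two_le
    omega
  -- a Heegner datum: ANY parametrisation at the conductor level (modularity), a Heegner datum of
  -- discriminant `d_K` (Gross 1984 §I.1), an embedding, and the Heegner point over `K` (Darmon 2004 Thm. 3.6)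
  obtain ⟨Dt⟩ := hmodP W
  obtain ⟨β, hβ⟩ := exists_dvd_sq_sub_discr_holds (W.conductorNorm ℤ) K hK hHN
  obtain ⟨H, -⟩ := nonempty_heegnerDatum_holds (W.conductorNorm ℤ) K hK hβ
  obtain ⟨ι⟩ : Nonempty (K →+* ℂ) := inferInstance
  obtain ⟨P, hP⟩ := heegnerPointComplex_mem_range_map_holds (W.conductorNorm ℤ) W K hK hHN Dt H ι
  -- a globally minimal model of the twist (Néron; Silverman VIII.8 Cor. 8.3)
  have hD0 : (NumberField.discr K : ℚ) ≠ 0 := by exact_mod_cast NumberField.discr_ne_zero K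
  haveI hEt : (W.quadraticTwist (NumberField.discr K : ℚ)).IsElliptic :=
    W.isElliptic_quadraticTwist hD0
  obtain ⟨Cd, hCd⟩ := hasGlobalMinimalModel_rat_holds (W.quadraticTwist (NumberField.discr K : ℚ))
  haveI : (Cd • W.quadraticTwist (NumberField.discr K : ℚ)).IsGloballyMinimal := hCd
  have hWd : Cd • W.quadraticTwist (NumberField.discr K : ℚ) =
      Cd • W.quadraticTwist (NumberField.discr K : ℚ) := rfl
  exact missingLowerBoundAt_rankOne_additive_of_indexLowerBoundAt_maninFree W p K Dt H ι P (hGZ _ W K)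
    (hKo _ W K) hKatoT hGZK hmod hr hp2 hadd hj hsurj hK hHN hP hμ hLt
    (Cd • W.quadraticTwist (NumberField.discr K : ℚ)) Cd hWd
    (hL W p _ K Dt H ι P hr ⟨hp2, hadd, hG, he⟩ hsurj rfl hK hHN hP)

end Summit.BirchSwinnertonDyer.BirchSwinnertonDyer.Theorems.AdditiveBranchIMCGordTwoRankOne.HeegnerKolyvagin

end
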